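import Literature.Topology.FourManifolds.FrameAlongLoopOrientation
import Mathlib.LinearAlgebra.Matrix.Adjugate
import Mathlib.LinearAlgebra.Matrix.ToLinearEquiv
import HarnessLib

/-!
# Coefficients of a continuous section in a continuous frame are continuous

Topic `Topology/FourManifolds`; namespace `Literature.Topology.FourManifolds`.  Theorems only;
no named fact, no `sorry`.  Along a path `γ : ℝ → M` in a `4`-manifold let `f₀(t), …, f₃(t)` be
continuous sections of `TM` (continuity in the tangent bundle) forming a basis of `T_{γ t}M` for
every `t`, and `V(t)` a further continuous section.  Then the coefficient functions `cᵢ(t)` of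
`V(t) = Σ cᵢ(t) fᵢ(t)` are continuous (`continuous_frameCoefficients`).  Proof: near `t₀`, read
everything in the trivialisation of `TM` at `γ t₀` (the tangent coordinate change, a linear
isomorphism of the model space for `γ t` in the chart domain); there the frame and the section
are continuous vector-valued maps, and the coefficients are given by Cramer's rule.  Used to
transport the continuous minority field of an even zero circle (Perutz 2006, Prop. 2.2) into a
tubular chart.

## References

* J. M. Lee, *Introduction to Smooth Manifolds*, 2nd ed. (2013), Ch. 10 (local frames; the
  component functions of a continuous section in a continuous local frame are continuous).
  [LeeSmoothManifolds2013]
* T. Perutz, *Zero-sets of near-symplectic forms*, J. Symplectic Geom. 4 (2006), Prop. 2.2.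
  [Perutz2006]
-/

noncomputable section

open Bundle Set Filter Module Function Matrix
open scoped Manifold Topology Matrix ContDiff

namespace Literature.Topology.FourManifolds

variable {M : Type*} [TopologicalSpace M] [ChartedSpace (EuclideanSpace ℝ (Fin 4)) M]
  [IsManifold (𝓡 4) ∞ M]

/-- Cramer's rule solves uniquely: if `A x = b` then `cramer A b = det A • x`. [folklore] -/
theorem cramer_eq_det_smul_of_mulVec_eq {A : Matrix (Fin 4) (Fin 4) ℝ} {x b : Fin 4 → ℝ}
    (h : A *ᵥ x = b) : cramer A b = A.det • x := by
  rw [cramer_eq_adjugate_mulVec, ← h, mulVec_mulVec, adjugate_mul, smul_mulVec, one_mulVec]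

/-- The matrix with columns `g i` applied to `c` is the combination `Σ cᵢ gᵢ`. [folklore] -/
theorem of_cols_mulVec (g : Fin 4 → EuclideanSpace ℝ (Fin 4)) (c : Fin 4 → ℝ) :
    (Matrix.of fun k i ↦ g i k) *ᵥ c = (WithLp.ofLp (∑ i, c i • g i) : Fin 4 → ℝ) := by
  funext k
  simp only [Matrix.mulVec, dotProduct, Matrix.of_apply, WithLp.ofLp_sum, WithLp.ofLp_smul,
    Finset.sum_apply, Pi.smul_apply, smul_eq_mul]
  exact Finset.sum_congr rfl fun i _ ↦ mul_comm _ _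

/-- **The coefficients of a continuous section of `TM` along a path in a continuous frame are
continuous.** [cite: LeeSmoothManifolds2013, Ch. 10] -/
theorem continuous_frameCoefficients {γ : ℝ → M} {f : ℝ → Fin 4 → EuclideanSpace ℝ (Fin 4)}
    {V : ℝ → EuclideanSpace ℝ (Fin 4)}
    (hf : ∀ i, Continuous fun t ↦
      (TotalSpace.mk' (EuclideanSpace ℝ (Fin 4)) (γ t) (f t i) : TangentBundle (𝓡 4) M))
    (hV : Continuous fun t ↦
      (TotalSpace.mk' (EuclideanSpace ℝ (Fin 4)) (γ t) (V t) : TangentBundle (𝓡 4) M))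
    (hli : ∀ t, LinearIndependent ℝ (f t)) :
    ∃ c : ℝ → Fin 4 → ℝ, Continuous c ∧ ∀ t, V t = ∑ i, c t i • f t i := by
  classical
  -- the basis and the coefficients, pointwise
  have hcard : ∀ t : ℝ, Fintype.card (Fin 4) = finrank ℝ (EuclideanSpace ℝ (Fin 4)) :=
    fun _ ↦ by simp
  set B : ℝ → Basis (Fin 4) ℝ (EuclideanSpace ℝ (Fin 4)) := fun t ↦
    basisOfLinearIndependentOfCardEqFinrank (hli t) (hcard t) with hB
  have hBf : ∀ t, ⇑(B t) = f t := fun t ↦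
    coe_basisOfLinearIndependentOfCardEqFinrank (hli t) (hcard t)
  set c : ℝ → Fin 4 → ℝ := fun t i ↦ (B t).repr (V t) i with hc
  have hsum : ∀ t, V t = ∑ i, c t i • f t i := fun t ↦ by
    conv_lhs => rw [← (B t).sum_repr (V t)]
    simp only [hBf]
    rfl
  refine ⟨c, continuous_iff_continuousAt.2 fun t₀ ↦ ?_, hsum⟩
  -- continuity of `γ`
  have hγc : Continuous γ :=
    (FiberBundle.continuous_proj (EuclideanSpace ℝ (Fin 4))
      (TangentSpace (𝓡 4) : M → Type _)).comp (hf 0)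
  set x₀ := γ t₀ with hx₀
  have hsrc : ∀ᶠ t in 𝓝 t₀, γ t ∈ (extChartAt (𝓡 4) x₀).source :=
    hγc.continuousAt.preimage_mem_nhds (extChartAt_source_mem_nhds (I := 𝓡 4) x₀)
  -- the frame and the section read in the trivialisation at `x₀`
  set Φ := trivializationAt (EuclideanSpace ℝ (Fin 4)) (TangentSpace (𝓡 4) : M → Type _) x₀
    with hΦ
  set g : ℝ → Fin 4 → EuclideanSpace ℝ (Fin 4) := fun t i ↦ (Φ ⟨γ t, f t i⟩).2 with hg
  set gV : ℝ → EuclideanSpace ℝ (Fin 4) := fun t ↦ (Φ ⟨γ t, V t⟩).2 with hgV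
  have hg_eq : ∀ t i, g t i = tangentCoordChange (𝓡 4) (γ t) x₀ (γ t) (f t i) := fun t i ↦ rfl
  have hgV_eq : ∀ t, gV t = tangentCoordChange (𝓡 4) (γ t) x₀ (γ t) (V t) := fun t ↦ rfl
  have hcont : ∀ {s : ℝ → EuclideanSpace ℝ (Fin 4)},
      Continuous (fun t ↦ (TotalSpace.mk' (EuclideanSpace ℝ (Fin 4)) (γ t) (s t) :
        TangentBundle (𝓡 4) M)) → ContinuousAt (fun t ↦ (Φ ⟨γ t, s t⟩).2) t₀ := by
    intro s hs
    have hmem : (TotalSpace.mk' (EuclideanSpace ℝ (Fin 4)) (γ t₀) (s t₀) : TangentBundle (𝓡 4) M)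
        ∈ Φ.source := by
      rw [hΦ, TangentBundle.trivializationAt_source]
      exact mem_chart_source (EuclideanSpace ℝ (Fin 4)) x₀
    have h1 : ContinuousAt Φ (TotalSpace.mk' (EuclideanSpace ℝ (Fin 4)) (γ t₀) (s t₀)) :=
      Φ.continuousOn.continuousAt (Φ.open_source.mem_nhds hmem)
    exact (ContinuousAt.comp (f := fun t ↦ (TotalSpace.mk' (EuclideanSpace ℝ (Fin 4)) (γ t) (s t) :
      TangentBundle (𝓡 4) M)) (x := t₀) h1 hs.continuousAt).snd
  have hgc : ∀ i, ContinuousAt (fun t ↦ g t i) t₀ := fun i ↦ hcont (hf i)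
  have hgVc : ContinuousAt gV t₀ := hcont hV
  -- the matrix of the transported frame and Cramer's formula for the coefficients
  set Gm : ℝ → Matrix (Fin 4) (Fin 4) ℝ := fun t ↦ Matrix.of fun k i ↦ g t i k with hGm
  have hGmc : ContinuousAt Gm t₀ := by
    refine continuousAt_pi.2 fun k ↦ continuousAt_pi.2 fun i ↦ ?_
    exact ((EuclideanSpace.proj k).continuous.continuousAt).comp (hgc i)
  have hrel : ∀ᶠ t in 𝓝 t₀, Gm t *ᵥ c t = WithLp.ofLp (gV t) ∧ (Gm t).det ≠ 0 := by
    filter_upwards [hsrc] with t ht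
    obtain ⟨L, hL⟩ := exists_linearEquiv_tangentCoordChange (I := 𝓡 4) ht
    have hLg : ∀ i, L (f t i) = g t i := fun i ↦ by
      rw [hg_eq, ← LinearEquiv.coe_coe, hL]; rfl
    have hLV : L (V t) = gV t := by rw [hgV_eq, ← LinearEquiv.coe_coe, hL]; rfl
    constructor
    · rw [hGm, of_cols_mulVec, ← hLV, hsum t, map_sum]
      simp only [map_smul, hLg]
    · -- the transported frame is independent, so the matrix of columns is non-singular
      have hli' : LinearIndependent ℝ (g t) := by
        have := (hli t).map' (L : EuclideanSpace ℝ (Fin 4) →ₗ[ℝ] EuclideanSpace ℝ (Fin 4))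
          L.ker
        have hfun : (⇑(L : EuclideanSpace ℝ (Fin 4) →ₗ[ℝ] EuclideanSpace ℝ (Fin 4)) ∘ f t) = g t :=
          funext fun i ↦ hLg i
        rwa [hfun] at this
      intro hdet
      obtain ⟨v, hv0, hv⟩ := Matrix.exists_mulVec_eq_zero_iff.2 hdet
      rw [hGm, of_cols_mulVec] at hv
      have hsum0 : ∑ i, v i • g t i = 0 := by
        have := congrArg (WithLp.toLp 2) hv
        simpa using this
      exact hv0 (funext fun i ↦ Fintype.linearIndependent_iff.1 hli' v hsum0 i)
  -- Cramer's formula, valid near `t₀`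
  have hcramer : ∀ᶠ t in 𝓝 t₀,
      c t = ((Gm t).det)⁻¹ • cramer (Gm t) (WithLp.ofLp (gV t)) := by
    filter_upwards [hrel] with t ht
    rw [cramer_eq_det_smul_of_mulVec_eq ht.1, smul_smul, inv_mul_cancel₀ ht.2, one_smul]
  -- continuity of the right-hand side at `t₀`
  have hgVc' : ContinuousAt (fun t ↦ (WithLp.ofLp (gV t) : Fin 4 → ℝ)) t₀ :=
    continuousAt_pi.2 fun k ↦ ((EuclideanSpace.proj k).continuous.continuousAt).comp hgVc
  have hdetc : ContinuousAt (fun t ↦ (Gm t).det) t₀ :=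
    (continuous_id.matrix_det).continuousAt.comp hGmc
  have hcrc : ContinuousAt (fun t ↦ cramer (Gm t) (WithLp.ofLp (gV t))) t₀ := by
    refine continuousAt_pi.2 fun i ↦ ?_
    simp only [cramer_apply]
    -- `t ↦ (Gm t).updateCol i (gV t)` is continuous at `t₀`, entrywise
    have hup : ContinuousAt (fun t ↦ (Gm t).updateCol i (WithLp.ofLp (gV t))) t₀ := by
      refine continuousAt_pi.2 fun k ↦ continuousAt_pi.2 fun j ↦ ?_
      by_cases hj : j = i
      · subst hj
        simp only [updateCol_self]
        exact (continuousAt_pi.1 hgVc') k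
      · simp only [updateCol_ne hj]
        exact (continuousAt_pi.1 ((continuousAt_pi.1 hGmc) k)) j
    exact (continuous_id.matrix_det).continuousAt.comp hup
  have hdet0 : (Gm t₀).det ≠ 0 := (hrel.self_of_nhds).2
  have hR : ContinuousAt (fun t ↦ ((Gm t).det)⁻¹ • cramer (Gm t) (WithLp.ofLp (gV t))) t₀ :=
    (hdetc.inv₀ hdet0).smul hcrc
  exact hR.congr (hcramer.mono fun t ht ↦ ht.symm)

end Literature.Topology.FourManifolds

end
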